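import Summits.AtomisticToContinuum.BoseEinsteinCondensation.Theses.BECThomsonPrinciple
import Literature.MathematicalPhysics.QuantumManyBody.PeriodicBoseGasFracEnergy
import Literature.MathematicalPhysics.QuantumManyBody.PeriodicBoseGasUpperBoundProofs

/-!
# Line `healing-split-kinetic-defect` for crux `FibreConductance` (stmt-AtomisticToContinuum-9480) — skeleton

Route `BECThomsonPrinciple` (rank-3 crux). The crux, for bounded repulsive finite-range `v`, every
window parameter `M`, exact zero-free `C¹` minimisers `Φ` on the torus and window momenta
`k = 2πn/L`, `|k| ≤ M√ρ̄`: ONE flow `J` in the `x₀`-fibre with weak divergence the fibre-neutral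
charge `q = L^{-3/2}(e^{ik·x₀}ψ − βψ²)` and bath-averaged cost `∫|J|²W/ψ² ≤ C L²/‖n‖²`
(`W(X̂) = ∫|Φ(y,X̂)|²dy`, `ψ = |Φ|/√W`, `β = ∫e^{ik·y}ψ dy`).

**Idea (card `healing-split-kinetic-defect`, triage r1-1/2/3: pass).** Transport the charge along
the conditional amplitude itself: `J₀ = L^{-3/2} e^{ik·x₀} ψ k/(i|k|²)`. Two exact identities:
`|J₀|²W/ψ² = L⁻³W/|k|²` pointwise, so `cost(J₀) = 1/|k|² = L²/(4π²|n|₂²)` in EVERY landscape (the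
Disproof §E floor `not_fibreConductanceSharp`, on the nose), and `div₀ J₀ = q + ε` with the neutral
DEFECT CHARGE `ε = L^{-3/2}[e^{ik·x₀}(k·∇₀ψ)/(i|k|²) + βψ²]` — a GRADIENT of the conditional
amplitude. By Thomson/Lax–Milgram the crux is then "`‖ε‖²_{H⁻¹(ψ²/W)} = O(1/k²)`" (`stub_transportReduction`).
The defect's dual norm is split at the HEALING SCALE `ℓ = L/(ν+1)`, `ν = ⌊L√(ρ̄a)⌋` (so
`ℓ²ρ̄a ≤ 1`, `1/ℓ ≤ √(ρ̄a) + 1/L`), by BLOCK AVERAGING over the `(ν+1)³` cubes of the fibre (not by a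
Fourier cut — triage r1-1/2/3: Fourier projection is unbounded on the weighted space and would pay the
random comparability factor `s(X̂)`): `defectDual ≤ 2·ℓ²·cageIntegral + 12·coarseIntegral`
(`stub_twoScaleSplit`; two Cauchy–Schwarz localisations, the local weighted Poincaré factors `σ_Q(X̂)`
and the effective conductances `g_{Q,l}(X̂)` between adjacent cube averages being DEFINED as the sup /
inf of the relevant ratios). The fine-scale term is the `σ`-weighted, Lebesgue-weighted Fisher
information of `ψ` at the healing scale; it is paid by the kinetic energy per particle
`∫W|∇₀ψ|² ≤ T/N ≤ E₀/N ≤ 4πρ̄a(1+o(1))` (diamagnetic inequality + Bose symmetry + Dyson's bound, the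
PROVED `LSSY2005_upperBound_periodic_holds`; `stub_kineticBudget`) through the cage-moment input
`stub_cageMoments` (local Poincaré factors of the conditional law have uniformly bounded moments
jointly with the local defect density — the crux's "cage half", localised). The coarse term is a
RANDOM-CONDUCTANCE lattice `H⁻¹` norm of the cube charges; `stub_coarseCages` (sparse bad cubes /
Grimmett–Kesten–Zhang detours; cage half at the coarse scale) compares it with the deterministic
flat-conductance lattice norm, which IS diagonal in lattice Fourier modes, so bath expectations pass
to one-mode occupations `E_W|ψ̂(p′)|² = L³n_{p′}/N` with no comparability factor: non-resonant
modes are free (`Σ_p n_p = N`, `PeriodicTrialState.tsum_cellOccupation_planeWaveMode`), aliased high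
modes are paid by the flat Fisher budget, and the RESONANT BEAT SHELL `0 < |p′ + k| ≲ 1/ℓ` is paid
by a KLS-shaped occupation bound `n_{p′} ≤ K(1 + √ρ̄/|p′|)` — empty for `|n| = 1` and for
`ρ̄aL² ≲ 1`, otherwise `≤ K M c √(ρ̄a)` after `ρ̄ ≤ ρ₀(K, M)` (`stub_beatCount`). That occupation
bound (with a bath structure-factor bound for the `β`-channel) is the crux's entire
thermodynamic-limit content (InfraredNecessity, item evidence 2026-08-15T22:51:58Z; triage panel
note) and is registered honestly as the HARDEST stub `stub_infraredInput` (BEC-adjacent for exact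
minimisers; the planners'/triagers' re-cut advice `9480 ↦ FibreConductanceUnderIR` = this skeleton
minus that stub).

**Disproof.lean v5 honoured** (read through its evidence abstracts; `run/gate/evidence` is not mounted
in planner jails): §E — the main term of `stub_transportReduction` IS the floor `L²/(4π²|n|₂²)`, the
line claims `C = 1/(2π²) + 2D`; §G1/§G3 — at `v = 0`, `ψ` is constant, `ε ≡ 0`, `J₀ = canonicalFlow`;
§G2 `not_fibreConductanceWithoutMinimiser` — (H1) `periodicEnergy v Φ = E₀` is a binder of exactly the
four bath-law stubs (`kineticBudget`, `cageMoments`, `coarseCages`, `infraredInput`); the slab-cage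
product state breaks `stub_cageMoments`/`stub_coarseCages` (its `σ`, `g⁻¹` are `e^{+2K}`), never the
deterministic stubs; §F — bounded `v` is carried as a binder only (hard cores self-vacuate); §D — the
duality behind `defectDual`. No `Negative/` lemma has landed for this crux (nothing to import).

Stubs (7, sorried, registered; statements = the `def`s below, audit aliases `Goal.stub_*`):
`stub_transportReduction` (M/L, deterministic), `stub_twoScaleSplit` (M, deterministic),
`stub_kineticBudget` (M, provable now from the tree), `stub_cageMoments` (L/XL, cage half — fine
scale), `stub_coarseCages` (L/XL, cage half — coarse scale), `stub_beatCount` (M/L, the card's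
computation), `stub_infraredInput` (XL, HARDEST, the IR content). Composition
`FibreConductance_of : Goal.stub_transportReduction → … → Goal.stub_infraredInput → FibreConductance`
is sorry-free (logic + `ℝ≥0∞` arithmetic); `fibreConductance_of_registered_stubs` applies it to the
seven stubs by name.
-/

noncomputable section

open MeasureTheory Filter
open scoped ENNReal NNReal BigOperators

namespace Summit.AtomisticToContinuum.BoseEinsteinCondensation.Cruxes.FibreConductance.HealingSplitKineticDefect

open Literature.MathematicalPhysics.QuantumManyBody.BoseGas
open Summit.AtomisticToContinuum.BoseEinsteinCondensation.Theses

variable {m : ℕ} {L : ℝ}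

/-! ## §0 Vocabulary of the crux (syntactically the `let`s of `BECThomsonPrinciple.FibreConductance`) -/

/-- Bath weight `W(X̂) = ∫_cell |Φ(y, X̂)|² dy` (the marginal density of the bath `X̂ = (x₁,…,x_m)`;
constant along the `x₀`-fibre). [folklore] -/
def bathW (Φ : PeriodicTrialState (m + 1) L) (X : Config (m + 1)) : ℝ :=
  ∫ y in cell L, ‖Φ.ψ (Function.update X 0 y)‖ ^ 2

/-- Conditional amplitude `ψ = |Φ|/√W` of particle `0` given the bath (`∫ ψ² dy = 1` on every fibre).
[folklore] -/
def condAmp (Φ : PeriodicTrialState (m + 1) L) (X : Config (m + 1)) : ℝ :=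
  ‖Φ.ψ X‖ / Real.sqrt (bathW Φ X)

/-- `β(X̂) = ∫ e^{ik·y} ψ(y, X̂) dy`. [folklore] -/
def beta (n : Fin 3 → ℤ) (Φ : PeriodicTrialState (m + 1) L) (X : Config (m + 1)) : ℂ :=
  ∫ y in cell L, Complex.exp (Complex.I * ↑(2 * Real.pi / L * ∑ j, (n j : ℝ) * y j)) *
    (condAmp Φ (Function.update X 0 y) : ℂ)

/-- The fibre-neutral charge `q = L^{-3/2}(e^{ik·x₀}ψ − βψ²)` of the crux. [folklore] -/
def charge (n : Fin 3 → ℤ) (Φ : PeriodicTrialState (m + 1) L) (X : Config (m + 1)) : ℂ :=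
  ((Real.sqrt (L ^ 3))⁻¹ : ℂ) *
    (Complex.exp (Complex.I * ↑(2 * Real.pi / L * ∑ j, (n j : ℝ) * X 0 j)) * (condAmp Φ X : ℂ) -
      beta n Φ X * (condAmp Φ X : ℂ) ^ 2)

/-- The unit vector `e_{0,l}` of particle `0`, axis `l`, in configuration space. [folklore] -/
def e0 (m : ℕ) (l : Fin 3) : Config (m + 1) :=
  Pi.single 0 (EuclideanSpace.single l (1 : ℝ))

/-- `C¹` test functions / potentials on the `N`-particle torus (periodic in every particle and axis):
the crux's class of `η`. [folklore] -/
def IsTest (L : ℝ) (F : Config (m + 1) → ℂ) : Prop :=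
  ContDiff ℝ 1 F ∧ ∀ (X : Config (m + 1)) (i : Fin (m + 1)) (l : Fin 3),
    F (X + Pi.single i (EuclideanSpace.single l L)) = F X

/-- Weak `x₀`-divergence: `J` is a flow of the charge `ρ` in the `x₀`-fibre,
`∫ J·∇₀η = −∫ ρ η` for every `C¹` periodic `η` (the crux's clause, verbatim). [folklore] -/
def IsFibreFlow (L : ℝ) (ρ : Config (m + 1) → ℂ) (J : Config (m + 1) → (Fin 3 → ℂ)) : Prop :=
  ∀ η : Config (m + 1) → ℂ, ContDiff ℝ 1 η →
    (∀ X (i : Fin (m + 1)) (l : Fin 3), η (X + Pi.single i (EuclideanSpace.single l L)) = η X) →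
    ∫ X in cellN (m + 1) L, ∑ l : Fin 3, J X l * fderiv ℝ η X (Pi.single 0 (EuclideanSpace.single l (1 : ℝ))) =
      - ∫ X in cellN (m + 1) L, ρ X * η X

/-- Thomson cost `∫ |J|² W/ψ²` of a fibre flow (the crux's left-hand side, verbatim). [folklore] -/
def fibreCost (Φ : PeriodicTrialState (m + 1) L) (J : Config (m + 1) → (Fin 3 → ℂ)) : ℝ≥0∞ :=
  ∫⁻ X in cellN (m + 1) L, ENNReal.ofReal ((∑ l : Fin 3, ‖J X l‖ ^ 2) * bathW Φ X / condAmp Φ X ^ 2)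

/-- The crux restated over this vocabulary (definitionally equal: `fibreConductance_iff`). [folklore] -/
def FibreConductance' : Prop :=
  ∀ v : ℝ → ℝ≥0∞, IsRepulsiveFiniteRange v → (∃ B : ℝ, ∀ r, v r ≤ ENNReal.ofReal B) →
    ∀ M : ℝ, 0 < M → ∃ ρ₀ C : ℝ, 0 < ρ₀ ∧ 0 < C ∧ ∃ N₀ : ℕ, ∀ m : ℕ, N₀ ≤ m + 1 →
      ∀ L : ℝ, 0 < L → ((m + 1 : ℕ) : ℝ) ≤ ρ₀ * L ^ 3 → ∀ n : Fin 3 → ℤ, n ≠ 0 →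
        2 * Real.pi * ‖(fun j => (n j : ℝ))‖ / L ≤ M * Real.sqrt ((m + 1 : ℕ) / L ^ 3) →
        ∀ Φ : PeriodicTrialState (m + 1) L,
          periodicEnergy v Φ = periodicGroundStateEnergy v (m + 1) L → (∀ X, Φ.ψ X ≠ 0) →
          ∃ J : Config (m + 1) → (Fin 3 → ℂ), IsFibreFlow L (charge n Φ) J ∧
            fibreCost Φ J ≤ ENNReal.ofReal (C * L ^ 2 / ‖(fun j => (n j : ℝ))‖ ^ 2)

/-- The restatement IS the crux (the `let`s of the route decl unfold to `bathW`, `condAmp`, `beta`,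
`charge`). [folklore] -/
theorem fibreConductance_iff : BECThomsonPrinciple.FibreConductance ↔ FibreConductance' := Iff.rfl

/-! ## §1 The line's objects -/

/-- `|k|² = (2π/L)² |n|₂²` (Euclidean; the crux's right-hand side uses the sup norm `‖n‖∞ ≤ |n|₂`).
[folklore] -/
def ksq (L : ℝ) (n : Fin 3 → ℤ) : ℝ :=
  (2 * Real.pi / L) ^ 2 * ∑ j, (n j : ℝ) ^ 2

/-- The TRANSPORT FLOW `J₀ = L^{-3/2} e^{ik·x₀} ψ · k/(i|k|²)` (transport of the charge along the
conditional amplitude; at `v = 0` the Disproof's `canonicalFlow`). Pointwise `|J₀|²W/ψ² = L⁻³W/|k|²`.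
[cite: LyonsPeres2016, Ch. 2 §2.4 (Thomson's principle: any unit flow bounds the effective resistance)] -/
def transportFlow (n : Fin 3 → ℤ) (Φ : PeriodicTrialState (m + 1) L) (X : Config (m + 1)) (l : Fin 3) : ℂ :=
  ((Real.sqrt (L ^ 3))⁻¹ : ℂ) * Complex.exp (Complex.I * ↑(2 * Real.pi / L * ∑ j, (n j : ℝ) * X 0 j)) *
    (condAmp Φ X : ℂ) * ((2 * Real.pi / L * (n l : ℝ) : ℝ) : ℂ) / (Complex.I * (ksq L n : ℂ))

/-- `∂_{0,l} ψ`: partial derivative of the conditional amplitude along axis `l` of particle `0`.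
[folklore] -/
def dAmp (Φ : PeriodicTrialState (m + 1) L) (X : Config (m + 1)) (l : Fin 3) : ℝ :=
  fderiv ℝ (condAmp Φ) X (e0 m l)

/-- The DEFECT CHARGE `ε = L^{-3/2}[e^{ik·x₀}(k·∇₀ψ)/(i|k|²) + βψ²]`: `div₀ J₀ = q + ε`, `∫ ε dy = 0`
on every fibre (`∫ e^{ik·y} k·∇ψ = −i|k|²β`, `∫ψ² = 1`); a pure gradient of `ψ` plus the `β`-channel.
[folklore] -/
def defect (n : Fin 3 → ℤ) (Φ : PeriodicTrialState (m + 1) L) (X : Config (m + 1)) : ℂ :=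
  ((Real.sqrt (L ^ 3))⁻¹ : ℂ) *
    (Complex.exp (Complex.I * ↑(2 * Real.pi / L * ∑ j, (n j : ℝ) * X 0 j)) *
        ((∑ l : Fin 3, 2 * Real.pi / L * (n l : ℝ) * dAmp Φ X l : ℝ) : ℂ) / (Complex.I * (ksq L n : ℂ)) +
      beta n Φ X * (condAmp Φ X : ℂ) ^ 2)

/-- Dual Dirichlet energy `E(F) = ∫ |∇₀F|² ψ²/W` (the form dual to the cost weight `W/ψ²`; Disproof §D).
[cite: LyonsPeres2016, Ch. 2 §2.4 (Dirichlet/Thomson duality)] -/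
def dualEnergy (Φ : PeriodicTrialState (m + 1) L) (F : Config (m + 1) → ℂ) : ℝ≥0∞ :=
  ∫⁻ X in cellN (m + 1) L,
    ENNReal.ofReal ((∑ l : Fin 3, ‖fderiv ℝ F X (e0 m l)‖ ^ 2) * condAmp Φ X ^ 2 / bathW Φ X)

/-- Squared dual norm `‖ε‖²_{H⁻¹(ψ²/W)} = sup_F |∫ ε F̄|² / E(F)` of the defect over `C¹` periodic test
functions (`0/0 = 0`: fibre-constant `F` pair to `0` by neutrality). By Thomson's principle this is
the least cost of a flow of `ε`. [cite: LyonsPeres2016, Ch. 2 §2.4] -/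
def defectDual (n : Fin 3 → ℤ) (Φ : PeriodicTrialState (m + 1) L) : ℝ≥0∞ :=
  ⨆ (F : Config (m + 1) → ℂ) (_ : IsTest L F),
    ENNReal.ofReal (‖∫ X in cellN (m + 1) L, defect n Φ X * (starRingEnd ℂ) (F X)‖ ^ 2) / dualEnergy Φ F

/-- HEALING-SCALE BLOCK COUNT: `ν = ⌊L √(ρ̄ a)⌋`, `ρ̄ = N/L³`; the fibre is tiled by `(ν+1)³` cubes of
side `ℓ = L/(ν+1)`, so `ℓ² ρ̄ a ≤ 1` and `1/ℓ ≤ √(ρ̄a) + 1/L` (one cube when `L√(ρ̄a) < 1`). [folklore] -/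
def healingBlocks (m : ℕ) (L a : ℝ) : ℕ :=
  ⌊L * Real.sqrt (((m + 1 : ℕ) : ℝ) / L ^ 3 * a)⌋₊

/-- The cube `Q` of the tiling of `[0,L)³` into `(ν+1)³` half-open cubes of side `L/(ν+1)`. [folklore] -/
def cubeSet (L : ℝ) (ν : ℕ) (Q : Fin 3 → Fin (ν + 1)) : Set Space :=
  {y | ∀ l, y l ∈ Set.Ico (((Q l : ℕ) : ℝ) * (L / (ν + 1))) ((((Q l : ℕ) : ℝ) + 1) * (L / (ν + 1)))}

/-- Cube average `⨍_Q F(y, X̂) dy` of a function along the `x₀`-fibre through `X`. [folklore] -/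
def cubeAvg (L : ℝ) (ν : ℕ) (F : Config (m + 1) → ℂ) (Q : Fin 3 → Fin (ν + 1)) (X : Config (m + 1)) : ℂ :=
  (((ν + 1 : ℕ) : ℝ) / L) ^ 3 • ∫ y in cubeSet L ν Q, F (Function.update X 0 y)

/-- LOCAL POINCARÉ FACTOR `σ_Q(X̂)` of the conditional law on cube `Q` (dimensionless): the best constant
in `∫_Q |F − ⨍_Q F|² ψ² dy ≤ σ_Q ℓ² ∫_Q |∇₀F|² ψ² dy` over `C¹` periodic `F` (flat average, weighted
norms — exactly what block averaging produces). In `d = 3` it is insensitive to point dips of `ψ` and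
charged only by closed shells (cages) at scale `≤ ℓ`; free value `O(1)`. [folklore] -/
def cubePoincare (L : ℝ) (ν : ℕ) (Φ : PeriodicTrialState (m + 1) L) (Q : Fin 3 → Fin (ν + 1))
    (X : Config (m + 1)) : ℝ≥0∞ :=
  ⨆ (F : Config (m + 1) → ℂ) (_ : IsTest L F),
    ENNReal.ofReal (∫ y in cubeSet L ν Q,
        ‖F (Function.update X 0 y) - cubeAvg L ν F Q X‖ ^ 2 * condAmp Φ (Function.update X 0 y) ^ 2) /
      ENNReal.ofReal ((L / (ν + 1)) ^ 2 * ∫ y in cubeSet L ν Q,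
        (∑ l : Fin 3, ‖fderiv ℝ F (Function.update X 0 y) (e0 m l)‖ ^ 2) *
          condAmp Φ (Function.update X 0 y) ^ 2)

/-- `σ(X)` = the local Poincaré factor of the cube containing `x₀`, in the bath `X̂`. [folklore] -/
def poincareFactor (L : ℝ) (ν : ℕ) (Φ : PeriodicTrialState (m + 1) L) (X : Config (m + 1)) : ℝ≥0∞ :=
  ∑ Q : Fin 3 → Fin (ν + 1), (cubeSet L ν Q).indicator (fun _ => cubePoincare L ν Φ Q X) (X 0)

/-- FINE-SCALE CAGE INTEGRAL `∫ σ · W |ε|²/ψ²` = bath expectation of the `σ`-weighted, Lebesgue-weighted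
defect density `Σ_Q σ_Q ∫_Q |ε|²/ψ² dy` (for the gradient part: `L⁻³|k|⁻² Σ_Q σ_Q ∫_Q |∇₀ log ψ|²`,
a comparability-weighted Fisher information; for the `β`-part: `L⁻³|β|² Σ_Q σ_Q μ(Q)`). [folklore] -/
def cageIntegral (L : ℝ) (ν : ℕ) (n : Fin 3 → ℤ) (Φ : PeriodicTrialState (m + 1) L) : ℝ≥0∞ :=
  ∫⁻ X in cellN (m + 1) L,
    poincareFactor L ν Φ X * ENNReal.ofReal (bathW Φ X * ‖defect n Φ X‖ ^ 2 / condAmp Φ X ^ 2)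

/-- CUBE CHARGE `c_Q(X̂) = ∫_Q ε(y, X̂) dy` (the block-averaged defect as a lattice charge; `Σ_Q c_Q = 0`).
[folklore] -/
def cubeCharge (L : ℝ) (ν : ℕ) (n : Fin 3 → ℤ) (Φ : PeriodicTrialState (m + 1) L)
    (Q : Fin 3 → Fin (ν + 1)) (X : Config (m + 1)) : ℂ :=
  ∫ y in cubeSet L ν Q, defect n Φ (Function.update X 0 y)

/-- EFFECTIVE CONDUCTANCE `g_{Q,l}(X̂)` between the averages over the adjacent cubes `Q`, `Q + e_l`
(periodic lattice `(ℤ/(ν+1))³`): `inf_F ∫_{Q ∪ (Q+e_l)} |∇₀F|²ψ² dy / |⨍_Q F − ⨍_{Q+e_l} F|²`; free value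
`≍ ℓ/L³`; small only across closed shells separating the two cubes. [folklore] -/
def edgeCond (L : ℝ) (ν : ℕ) (Φ : PeriodicTrialState (m + 1) L) (Q : Fin 3 → Fin (ν + 1)) (l : Fin 3)
    (X : Config (m + 1)) : ℝ≥0∞ :=
  ⨅ (F : Config (m + 1) → ℂ) (_ : IsTest L F),
    ENNReal.ofReal (∫ y in cubeSet L ν Q ∪ cubeSet L ν (Q + Pi.single l 1),
        (∑ l' : Fin 3, ‖fderiv ℝ F (Function.update X 0 y) (e0 m l')‖ ^ 2) *
          condAmp Φ (Function.update X 0 y) ^ 2) /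
      ENNReal.ofReal (‖cubeAvg L ν F Q X - cubeAvg L ν F (Q + Pi.single l 1) X‖ ^ 2)

/-- COARSE DUAL NORM: squared `H⁻¹` norm of the cube charges on the periodic cube lattice with the
random conductances `g_{Q,l}(X̂)`: `sup_a |Σ_Q c_Q ā_Q|² / Σ_{Q,l} g_{Q,l}|a_{Q+e_l} − a_Q|²`. [cite: LyonsPeres2016, Ch. 2 §2.4 (network energy / effective resistance duality)] -/
def coarseDual (L : ℝ) (ν : ℕ) (n : Fin 3 → ℤ) (Φ : PeriodicTrialState (m + 1) L) (X : Config (m + 1)) :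
    ℝ≥0∞ :=
  ⨆ a : (Fin 3 → Fin (ν + 1)) → ℂ,
    ENNReal.ofReal (‖∑ Q, cubeCharge L ν n Φ Q X * (starRingEnd ℂ) (a Q)‖ ^ 2) /
      (∑ Q, ∑ l : Fin 3, edgeCond L ν Φ Q l X * ENNReal.ofReal (‖a (Q + Pi.single l 1) - a Q‖ ^ 2))

/-- FLAT COARSE DUAL NORM: the same lattice `H⁻¹` norm with the deterministic free conductance
`g₀ = ℓ/L³` on every edge (diagonal in lattice Fourier modes). [cite: LyonsPeres2016, Ch. 2 §2.4] -/
def flatCoarseDual (L : ℝ) (ν : ℕ) (n : Fin 3 → ℤ) (Φ : PeriodicTrialState (m + 1) L)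
    (X : Config (m + 1)) : ℝ≥0∞ :=
  ⨆ a : (Fin 3 → Fin (ν + 1)) → ℂ,
    ENNReal.ofReal (‖∑ Q, cubeCharge L ν n Φ Q X * (starRingEnd ℂ) (a Q)‖ ^ 2) /
      (∑ Q, ∑ l : Fin 3, ENNReal.ofReal (L / (ν + 1) / L ^ 3) * ENNReal.ofReal (‖a (Q + Pi.single l 1) - a Q‖ ^ 2))

/-- COARSE CAGE INTEGRAL `E_W[coarseDual]` (written as `∫ |Φ|² · coarseDual(X̂) dX`, the integrand being
fibre-constant). [folklore] -/
def coarseIntegral (L : ℝ) (ν : ℕ) (n : Fin 3 → ℤ) (Φ : PeriodicTrialState (m + 1) L) : ℝ≥0∞ :=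
  ∫⁻ X in cellN (m + 1) L, ENNReal.ofReal (‖Φ.ψ X‖ ^ 2) * coarseDual L ν n Φ X

/-- FLAT COARSE INTEGRAL `E_W[flatCoarseDual]`. [folklore] -/
def flatCoarseIntegral (L : ℝ) (ν : ℕ) (n : Fin 3 → ℤ) (Φ : PeriodicTrialState (m + 1) L) : ℝ≥0∞ :=
  ∫⁻ X in cellN (m + 1) L, ENNReal.ofReal (‖Φ.ψ X‖ ^ 2) * flatCoarseDual L ν n Φ X

/-- FIBRE FISHER INFORMATION `∫ W |∇₀ψ|² dX = E_W ∫ |∇_y ψ|² dy` (`= ∫ |∇₀|Φ||² ≤ T(Φ)/N`).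
[folklore] -/
def fibreFisher (Φ : PeriodicTrialState (m + 1) L) : ℝ≥0∞ :=
  ∫⁻ X in cellN (m + 1) L, ENNReal.ofReal (bathW Φ X * ∑ l : Fin 3, dAmp Φ X l ^ 2)

/-- KINETIC BUDGET at level `(C_F, ρ_F, N_F)`: exact zero-free minimisers at density `≤ ρ_F` have kinetic
energy `T(Φ) ≤ C_F ρ̄ a N` (hence kinetic Chebyshev `n_p ≤ T/|p|²` for single modes) and fibre Fisher
information `∫W|∇₀ψ|² ≤ C_F ρ̄ a` (`a` = scattering length). The conclusion shape of `stub_kineticBudget`,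
consumed by `stub_cageMoments` and `stub_beatCount`. [cite: LSSY2005, Thm. 2.2 (2.14)] -/
def KineticBudget (v : ℝ → ℝ≥0∞) (C_F ρ_F : ℝ) (N_F : ℕ) : Prop :=
  ∀ m : ℕ, N_F ≤ m + 1 → ∀ L : ℝ, 0 < L → ((m + 1 : ℕ) : ℝ) ≤ ρ_F * L ^ 3 →
    ∀ Φ : PeriodicTrialState (m + 1) L,
      periodicEnergy v Φ = periodicGroundStateEnergy v (m + 1) L → (∀ X, Φ.ψ X ≠ 0) →
      (∫⁻ X in cellN (m + 1) L, kineticDensity Φ.ψ X) ≤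
          ENNReal.ofReal (C_F * (((m + 1 : ℕ) : ℝ) / L ^ 3) * (scatteringLength v).toReal * (m + 1 : ℕ)) ∧
        fibreFisher Φ ≤ ENNReal.ofReal (C_F * (((m + 1 : ℕ) : ℝ) / L ^ 3) * (scatteringLength v).toReal)

/-- THIN-SHELL OCCUPATION hypothesis at level `K` for the window mode `n`: KLS-shaped one-mode bounds
`n_{p} ≤ K (1 + √ρ̄ / |2πp/L|)` on the beat shell `‖p + n‖∞ ≤ L√(ρ̄a)` (`2π ×` healing momentum, in
lattice units), `p ≠ 0`. Empty content when `L√(ρ̄a) < 1` except `p = −n`. [cite: KennedyLiebShastry1988, Thm. (infrared bound ⇒ occupation bound, lattice T = 0)] -/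
def ShellOcc (K : ℝ) (m : ℕ) (L a : ℝ) (n : Fin 3 → ℤ) (Φ : PeriodicTrialState (m + 1) L) : Prop :=
  ∀ p : Fin 3 → ℤ, p ≠ 0 →
    ‖(fun j => ((p j + n j : ℤ) : ℝ))‖ ≤ L * Real.sqrt (((m + 1 : ℕ) : ℝ) / L ^ 3 * a) →
    (cellOccupation (m + 1) L (planeWaveMode L p) Φ.ψ).toReal ≤
      K * (1 + Real.sqrt (((m + 1 : ℕ) : ℝ) / L ^ 3) / (2 * Real.pi * ‖(fun j => (p j : ℝ))‖ / L))

/-- BATH STRUCTURE-FACTOR hypothesis at level `K`: `S_N(p) = N⁻¹⟨|Σ_i e^{2πi p·x_i/L}|²⟩ ≤ K` for the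
lattice momenta `0 < ‖p‖∞ ≤ L√(ρ̄a)` (no macroscopic density fluctuation down to the healing scale; what
the `β`-channel of the coarse charge needs). [cite: Feynman1954, §(structure factor of the Bose liquid); PitaevskiiStringari1991 (S(k) bounds from sum rules)] -/
def StructureBound (K : ℝ) (m : ℕ) (L a : ℝ) (Φ : PeriodicTrialState (m + 1) L) : Prop :=
  ∀ p : Fin 3 → ℤ, p ≠ 0 → ‖(fun j => (p j : ℝ))‖ ≤ L * Real.sqrt (((m + 1 : ℕ) : ℝ) / L ^ 3 * a) →
    ∫⁻ X in cellN (m + 1) L,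
        ENNReal.ofReal (‖∑ i : Fin (m + 1), Complex.exp (Complex.I * ↑(2 * Real.pi / L * ∑ j, (p j : ℝ) * X i j))‖ ^ 2 *
          ‖Φ.ψ X‖ ^ 2) ≤
      ENNReal.ofReal (K * (m + 1 : ℕ))

/-! ## §2 The seven stub STATEMENTS -/

/-- **S1 — transport reduction (deterministic; M/L).** For every zero-free periodic `C¹` state (no
minimality, no `v`): if the defect has dual norm `‖ε‖² ≤ D·L²/‖n‖²` then there is a flow `J_ε` OF THE
DEFECT such that `J = J₀ − J_ε` is the crux's flow, with cost `≤ (1/(2π²) + 2D) L²/‖n‖²`. Mechanism: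
`J₀ = transportFlow` (weak divergence
`q + ε` by periodic integration by parts along `x₀`, cost EXACTLY `L²/(4π²|n|₂²) ≤ L²/(4π²‖n‖∞²)`:
`|J₀|²W/ψ² = L⁻³W/|k|²`, `∫_{cellN} W = L³`) and `J_ε = (ψ²/W)∇₀u`, `u` the Lax–Milgram / Riesz solution
of `div₀((ψ²/W)∇₀u) = ε` in the completion of `C¹` periodic functions under `dualEnergy` (cost
`= defectDual`); parallelogram bound `cost(J₀ − J_ε) ≤ 2cost(J₀) + 2cost(J_ε)`. Why it might fail: only
technically (the weak solution's flow must be an honest function with Bochner-integrable pairings: it is,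
since `W/ψ² = W²/|Φ|²` is continuous and bounded below on the compact cell). Free check: `ε = 0`, `D = 0`
gives `C = 1/(2π²) ≥` the Disproof floor `1/(4π²)`. [cite: LyonsPeres2016, Ch. 2 §2.4 (Thomson's principle); doi:10.1063/1.1734192 (Prager–Hirschfelder: trial fields bound second-order energies)] -/
def TransportReduction : Prop :=
  ∀ (m : ℕ) (L : ℝ), 0 < L → ∀ n : Fin 3 → ℤ, n ≠ 0 → ∀ Φ : PeriodicTrialState (m + 1) L,
    (∀ X, Φ.ψ X ≠ 0) → ∀ D : ℝ, 0 ≤ D →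
      defectDual n Φ ≤ ENNReal.ofReal (D * L ^ 2 / ‖(fun j => (n j : ℝ))‖ ^ 2) →
      ∃ Jε : Config (m + 1) → (Fin 3 → ℂ), IsFibreFlow L (defect n Φ) Jε ∧
        IsFibreFlow L (charge n Φ) (fun X l => transportFlow n Φ X l - Jε X l) ∧
        fibreCost Φ (fun X l => transportFlow n Φ X l - Jε X l) ≤
          ENNReal.ofReal ((1 / (2 * Real.pi ^ 2) + 2 * D) * L ^ 2 / ‖(fun j => (n j : ℝ))‖ ^ 2)

/-- **S2 — two-scale split (deterministic; M).** For every zero-free state and every block count: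
`defectDual ≤ 2·ℓ²·cageIntegral + 12·coarseIntegral`, `ℓ = L/(ν+1)`. Mechanism: with the BLOCK AVERAGE
`ΠF = Σ_Q 1_Q(x₀) ⨍_Q F` (an orthogonal projection in flat `L²(dy)`), `F̄ = (F − ΠF)‾ + (ΠF)‾`,
`|a+b|² ≤ 2|a|² + 2|b|²`; HIGH part cube by cube: `|∫_Q ε(F − ⨍_Q F)‾| ≤ (∫_Q|ε|²/ψ²)^{1/2}
(σ_Q ℓ² ∫_Q|∇₀F|²ψ²)^{1/2}` (definition of `cubePoincare`), Cauchy–Schwarz over cubes and over the bath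
with weights `W`, `1/W` ⇒ `≤ ℓ²·cageIntegral·E(F)`; LOW part: `∫ ε (ΠF)‾ dy = Σ_Q c_Q (⨍_Q F)‾`,
lattice duality `|Σ c_Q ā_Q|² ≤ coarseDual · Σ g_{Q,l}|a_{Q+e_l} − a_Q|²` and
`g_{Q,l}|⨍_Q F − ⨍_{Q+e_l}F|² ≤ ∫_{Q∪(Q+e_l)}|∇₀F|²ψ²` (definition of `edgeCond` as an infimum), each cube
lying on `6` edges ⇒ `≤ 6·coarseDual·∫|∇₀F|²ψ² dy`, then Cauchy–Schwarz over the bath. Why it might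
fail: measurability of `X̂ ↦ σ_Q(X̂), g_{Q,l}(X̂)` (sup/inf over `C¹` test functions of continuous
ratios: lower/upper semicontinuous, hence Borel) and `0/0` conventions (numerators vanish whenever
denominators do: `ψ > 0`, neutrality `Σ_Q c_Q = 0`). [cite: GrimmettKestenZhang1993, §2 (flows from local pieces); LyonsPeres2016, Ch. 2 §2.4] -/
def TwoScaleSplit : Prop :=
  ∀ (m : ℕ) (L : ℝ), 0 < L → ∀ (ν : ℕ) (n : Fin 3 → ℤ), n ≠ 0 → ∀ Φ : PeriodicTrialState (m + 1) L,
    (∀ X, Φ.ψ X ≠ 0) →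
      defectDual n Φ ≤ 2 * (ENNReal.ofReal ((L / (ν + 1)) ^ 2) * cageIntegral L ν n Φ) +
        12 * coarseIntegral L ν n Φ

/-- **S3 — kinetic budget (M; provable now).** For bounded repulsive finite-range `v` there are
`C_F ≥ 0`, `ρ_F > 0`, `N_F` with `KineticBudget v C_F ρ_F N_F`: exact zero-free minimisers at density
`≤ ρ_F` have `∫W|∇₀ψ|² ≤ C_F ρ̄ a`. Mechanism: `W|∇₀ψ|² = |∇₀|Φ||² ≤ |∇₀Φ|²` (diamagnetic inequality,
`W` is fibre-constant), Bose symmetry `∫|∇₀Φ|² = T(Φ)/N`, `T(Φ) ≤ periodicEnergy v Φ = E₀` (`v ≥ 0`,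
(H1) used here), and Dyson's upper bound `E₀ ≤ 4πρ₁a(1 + 12 a/b)N` — the PROVED fact
`LSSY2005_upperBound_periodic_holds` (needs `2R₀ < L`, `a/b ≤ c`: both follow from `N ≥ N_F` large and
`ρ̄ ≤ ρ_F` small; `N = 1`: `E₀ = 0`). At `v = 0`: `a = 0` and the minimisers are constants
(Disproof §G3), both sides vanish. Why it might fail: it does not (bookkeeping of the LSSY regime
conditions; `scatteringLength v ≠ ⊤` from boundedness + finite range via `four_pi_mul_scatteringLength_le`).
[cite: LSSY2005, Thm. 2.2 (2.14)] -/
def KineticBudgetExists : Prop :=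
  ∀ v : ℝ → ℝ≥0∞, IsRepulsiveFiniteRange v → (∃ B : ℝ, ∀ r, v r ≤ ENNReal.ofReal B) →
    ∃ C_F ρ_F : ℝ, 0 ≤ C_F ∧ 0 < ρ_F ∧ ∃ N_F : ℕ, KineticBudget v C_F ρ_F N_F

/-- **S4 — cage moments at the healing scale (L/XL; the crux's cage half, fine scale; uses (H1)).**
Given the kinetic budget, for every window `M` there are `C₃ ≥ 0`, `ρ₀ > 0`, `N₀` such that in the
regime, for exact zero-free minimisers, `ℓ² · cageIntegral ≤ C₃ L²/‖n‖²` with `ν = healingBlocks`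
(`ℓ²ρ̄a ≤ 1`). Content: `|ε|²/ψ² ≤ 2L⁻³|∇₀ψ|²/(|k|²ψ²) + 2L⁻³|β|²ψ²`, so one needs (i) the
`σ`-weighted LEBESGUE-weighted local Fisher information `E_W[Σ_Q σ_Q ∫_Q |∇ log ψ|² dy] ≤ C ρ̄ a L³·(const)`
— per bath particle an `O(a)`-type contribution as in Dyson's bound, inflated by the dip constant
`e^{O(√B R₀)}` of a bounded core and by cluster statistics (exponential local-number tails of the Born
law of `Ψ₀`, the unproved "LocalNumberTail"/quantum Ruelle bound shared with cards
tagged-path-harnack-cage-moments and marginal-subsolution-shells) and (ii) uniform integrability of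
`σ` jointly with `|β|²/L³ ≤ 1` plus kinetic Chebyshev `n_k ≤ T/|k|²` for the `β`-part. `σ_Q` is a 3-D
local Poincaré factor: point dips of `ψ` are free, only closed shells inside a healing cube cost — the
tagged particle detours. Why it might fail: a heavy tail of `σ` (cages of depth `K` with probability
`≫ e^{−2K}`) under the ground-state bath law, or concentration of kinetic energy in cages; false for the
slab-cage non-minimiser of Disproof §G2 (that is where (H1) works). [cite: ReattoChester1967 (Jastrow ground-state heuristics); GrimmettKestenZhang1993, §2; LSSY2005, Thm. 2.2] -/
def CageMoments : Prop :=
  ∀ v : ℝ → ℝ≥0∞, IsRepulsiveFiniteRange v → (∃ B : ℝ, ∀ r, v r ≤ ENNReal.ofReal B) →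
    ∀ (C_F ρ_F : ℝ) (N_F : ℕ), KineticBudget v C_F ρ_F N_F →
    ∀ M : ℝ, 0 < M → ∃ C₃ : ℝ, 0 ≤ C₃ ∧ ∃ ρ₀ : ℝ, 0 < ρ₀ ∧ ∃ N₀ : ℕ, ∀ m : ℕ, N₀ ≤ m + 1 →
      ∀ L : ℝ, 0 < L → ((m + 1 : ℕ) : ℝ) ≤ ρ₀ * L ^ 3 → ∀ n : Fin 3 → ℤ, n ≠ 0 →
        2 * Real.pi * ‖(fun j => (n j : ℝ))‖ / L ≤ M * Real.sqrt ((m + 1 : ℕ) / L ^ 3) →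
        ∀ Φ : PeriodicTrialState (m + 1) L,
          periodicEnergy v Φ = periodicGroundStateEnergy v (m + 1) L → (∀ X, Φ.ψ X ≠ 0) →
          ENNReal.ofReal ((L / (healingBlocks m L (scatteringLength v).toReal + 1)) ^ 2) *
              cageIntegral L (healingBlocks m L (scatteringLength v).toReal) n Φ ≤
            ENNReal.ofReal (C₃ * L ^ 2 / ‖(fun j => (n j : ℝ))‖ ^ 2)

/-- **S5 — coarse cages (L/XL; the cage half at the coarse scale; uses (H1)).** For exact zero-free
minimisers in the regime the random-conductance lattice norm of the cube charges is bounded in bath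
expectation by a constant times the flat one: `coarseIntegral ≤ C_a · flatCoarseIntegral`. Content: bad
edges (`g_{Q,l} ≪ ℓ/L³`: a closed shell of `ψ` separating two healing cubes) are sparse under the
ground-state bath law and the cube charges (boundary-type oscillatory integrals `∫_Q e^{ik·y}k·∇ψ`,
not concentrated on clusters) can be rerouted around finite bad clusters at bounded relative cost —
a Grimmett–Kesten–Zhang / random-conductance flow argument in expectation, jointly in charges and
conductances. Why it might fail: correlation between large charges and bad edges, or bad edges
percolating at some density (then only the weaker form "`≤ C_a·flat + C L²/‖n‖²·o(1)`" may hold —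
reshape target); false without (H1) (Disproof §G2 slab: every edge across the slab is bad).
[cite: GrimmettKestenZhang1993, Thm. 1 and §2 (flows avoiding bad regions); LyonsPeres2016, Ch. 2 §2.4] -/
def CoarseCages : Prop :=
  ∀ v : ℝ → ℝ≥0∞, IsRepulsiveFiniteRange v → (∃ B : ℝ, ∀ r, v r ≤ ENNReal.ofReal B) →
    ∀ M : ℝ, 0 < M → ∃ C_a : ℝ, 0 ≤ C_a ∧ ∃ ρ₀ : ℝ, 0 < ρ₀ ∧ ∃ N₀ : ℕ, ∀ m : ℕ, N₀ ≤ m + 1 →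
      ∀ L : ℝ, 0 < L → ((m + 1 : ℕ) : ℝ) ≤ ρ₀ * L ^ 3 → ∀ n : Fin 3 → ℤ, n ≠ 0 →
        2 * Real.pi * ‖(fun j => (n j : ℝ))‖ / L ≤ M * Real.sqrt ((m + 1 : ℕ) / L ^ 3) →
        ∀ Φ : PeriodicTrialState (m + 1) L,
          periodicEnergy v Φ = periodicGroundStateEnergy v (m + 1) L → (∀ X, Φ.ψ X ≠ 0) →
          coarseIntegral L (healingBlocks m L (scatteringLength v).toReal) n Φ ≤
            ENNReal.ofReal C_a * flatCoarseIntegral L (healingBlocks m L (scatteringLength v).toReal) n Φ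

/-- **S6 — the beat count (M/L; the card's computation, flat conductances ⇒ no comparability factor).**
Given the kinetic budget, for all `M`, `K ≥ 0` there are `C_b ≥ 0`, `ρ₀(K, M) > 0`, `N₀` such that in the
regime, for exact zero-free minimisers satisfying `ShellOcc K` and `StructureBound K`:
`flatCoarseIntegral ≤ C_b L²/‖n‖²`. Content: with constant conductances `ℓ/L³` the lattice norm is
diagonal in lattice Fourier modes, `flatCoarseDual = (L³/ℓ)(ν+1)⁻³ Σ_{P̃≠0} |ĉ(P̃)|²/λ(P̃)`,
`λ(P̃) ≍ |P̃|²ℓ²`; cube charges are the continuum modes `ε̂(P)`, `P = p′ + k`, folded with weights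
vanishing linearly at aliased low modes; `ε̂₁(P) ∝ ((p′·k)/|k|²) ψ̂(p′)` and `E_W|ψ̂(p′)|² = L³ n_{p′}/N`
(exact minimisers are positive up to a phase). Then: aliased `|P| ≳ 1/ℓ` modes `≤ ℓ²·(flat Fisher)/|k|²
≤ ℓ² C_F ρ̄ a/|k|² ≤ C_F/|k|²`; non-resonant low modes weigh `≤ 4/|k|²` against `N⁻¹Σ_{p′} n_{p′} ≤ 1`
(`PeriodicTrialState.tsum_cellOccupation_planeWaveMode`); the resonant beat shell
`0 < |P| ≲ 1/ℓ ≤ √(ρ̄a) + 1/L` costs `≤ |k|·(max_shell n_{p′})·(1/ℓ)/(2π²ρ̄)·(1/|k|²)` which is EMPTY for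
`|n| = 1` and for `L√(ρ̄a) < 1` and otherwise `≤ K M (1 + 1/M)·c·√(ρ̄ a)/|k|² ≤ 1/|k|²` once
`ρ̄ ≤ ρ₀(K, M)`; the `β`-channel `L⁻³|β|²(ψ²)^(P)` is a product of two fibre coefficients, bounded via
`|β|²/L³ ↔ n_k ≤ T/|k|²` and `StructureBound` (`L⁻³Σ_{|P|<1/ℓ} S(P)/P² ≤ K√(ρ̄a)/2π²`). Why it might
fail: an aliasing or normalisation slip (checked: block form factors vanish linearly at aliased low
lattice modes, cancelling `1/λ`); in `d = 1` the shell sum is `∝ L` (PitaevskiiStringari barrier: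
consistent). [cite: KennedyLiebShastry1988 (occupation bounds of KLS shape); LSSY2005, §1.2 (1.17)–(1.18) (Parseval for occupations); PitaevskiiStringari1991] -/
def BeatCount : Prop :=
  ∀ v : ℝ → ℝ≥0∞, IsRepulsiveFiniteRange v → (∃ B : ℝ, ∀ r, v r ≤ ENNReal.ofReal B) →
    ∀ (C_F ρ_F : ℝ) (N_F : ℕ), KineticBudget v C_F ρ_F N_F →
    ∀ M : ℝ, 0 < M → ∀ K : ℝ, 0 ≤ K → ∃ C_b : ℝ, 0 ≤ C_b ∧ ∃ ρ₀ : ℝ, 0 < ρ₀ ∧ ∃ N₀ : ℕ,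
      ∀ m : ℕ, N₀ ≤ m + 1 → ∀ L : ℝ, 0 < L → ((m + 1 : ℕ) : ℝ) ≤ ρ₀ * L ^ 3 → ∀ n : Fin 3 → ℤ, n ≠ 0 →
        2 * Real.pi * ‖(fun j => (n j : ℝ))‖ / L ≤ M * Real.sqrt ((m + 1 : ℕ) / L ^ 3) →
        ∀ Φ : PeriodicTrialState (m + 1) L,
          periodicEnergy v Φ = periodicGroundStateEnergy v (m + 1) L → (∀ X, Φ.ψ X ≠ 0) →
          ShellOcc K m L (scatteringLength v).toReal n Φ →
          StructureBound K m L (scatteringLength v).toReal Φ →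
          flatCoarseIntegral L (healingBlocks m L (scatteringLength v).toReal) n Φ ≤
            ENNReal.ofReal (C_b * L ^ 2 / ‖(fun j => (n j : ℝ))‖ ^ 2)

/-- **S7 — the infrared input (XL; HARDEST; the crux's entire thermodynamic-limit content; uses (H1)).**
For bounded repulsive finite-range `v` and every window `M` there are `K ≥ 0`, `ρ₀ > 0`, `N₀` such that
every exact zero-free minimiser in the regime satisfies, for every window mode `n`, the thin-shell
occupation bound `ShellOcc K` and the structure bound `StructureBound K`. Content: a single-mode
occupation bound of KLS shape `n_{p′} ≤ K(1 + √ρ̄/|p′|)` on the beat shell around `−k` (what the route's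
own `GaussianDominationCan ⇒ GDTransfer` (KLS) chain outputs inside its window, and what
InfraredNecessity shows the crux FORCES: `n_{p′} ≲ C ρ̄L/|k|²` adjacent to `−k`), plus `S(P) ≤ K` down to
the healing momentum (Onsager/Feynman: `S ≤ √(f-sum · χ/N)`, i.e. a weak form of `DensityResponse`).
Honest status: BEC-adjacent for exact minimisers (window sum + kinetic Chebyshev ⇒ `n₀ ≥ (1 − o(1))N`);
no closure inside this crux (triage: the loop closures coupling-continuity / profile-descent fail at the
window edge); the tenure re-cut `9480 ↦ FibreConductanceUnderIR` deletes exactly this stub. Why it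
might fail: it is open — a rogue mode with `L^{1+ε}` particles at `|p| = M√ρ̄` costs only `L^{1+ε}M²ρ̄ ≪`
LHY slack, so no energy method gives it; the slab cage of Disproof §G2 (non-minimiser) violates it
(`n_{±2e} ≍ N`). [cite: KennedyLiebShastry1988; arXiv:1211.2778 (LNSS excitation operators, `Λ†Λ = n_k`); Feynman1954; FournaisSolovej2020] -/
def InfraredInput : Prop :=
  ∀ v : ℝ → ℝ≥0∞, IsRepulsiveFiniteRange v → (∃ B : ℝ, ∀ r, v r ≤ ENNReal.ofReal B) →
    ∀ M : ℝ, 0 < M → ∃ K : ℝ, 0 ≤ K ∧ ∃ ρ₀ : ℝ, 0 < ρ₀ ∧ ∃ N₀ : ℕ, ∀ m : ℕ, N₀ ≤ m + 1 →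
      ∀ L : ℝ, 0 < L → ((m + 1 : ℕ) : ℝ) ≤ ρ₀ * L ^ 3 → ∀ n : Fin 3 → ℤ, n ≠ 0 →
        2 * Real.pi * ‖(fun j => (n j : ℝ))‖ / L ≤ M * Real.sqrt ((m + 1 : ℕ) / L ^ 3) →
        ∀ Φ : PeriodicTrialState (m + 1) L,
          periodicEnergy v Φ = periodicGroundStateEnergy v (m + 1) L → (∀ X, Φ.ψ X ≠ 0) →
          ShellOcc K m L (scatteringLength v).toReal n Φ ∧ StructureBound K m L (scatteringLength v).toReal Φ

/-! ### Audit names of the stub statements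

`Goal.stub_x` abbreviates the statement of the registered stub `stub_x`, so that the skeleton audit
(`#h21_check_skeleton`, by-name policy on hypothesis heads) reads the hypotheses of `FibreConductance_of`
as exactly the seven declared stubs. -/

namespace Goal

/-- Statement of `stub_transportReduction`. -/
abbrev stub_transportReduction : Prop := TransportReduction
/-- Statement of `stub_twoScaleSplit`. -/
abbrev stub_twoScaleSplit : Prop := TwoScaleSplit
/-- Statement of `stub_kineticBudget`. -/
abbrev stub_kineticBudget : Prop := KineticBudgetExists
/-- Statement of `stub_cageMoments`. -/
abbrev stub_cageMoments : Prop := CageMoments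
/-- Statement of `stub_coarseCages`. -/
abbrev stub_coarseCages : Prop := CoarseCages
/-- Statement of `stub_beatCount`. -/
abbrev stub_beatCount : Prop := BeatCount
/-- Statement of `stub_infraredInput`. -/
abbrev stub_infraredInput : Prop := InfraredInput

end Goal

/-! ## §3 Registered stubs -/

/-- **Stub 1** (M/L, deterministic): transport identity + Thomson/Lax–Milgram — see `TransportReduction`.
[cite: LyonsPeres2016, Ch. 2 §2.4] -/
theorem stub_transportReduction : TransportReduction := by
  sorry

/-- **Stub 2** (M, deterministic): the two-scale block-average split — see `TwoScaleSplit`.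
[cite: GrimmettKestenZhang1993, §2] -/
theorem stub_twoScaleSplit : TwoScaleSplit := by
  sorry

/-- **Stub 3** (M, provable now): diamagnetic + symmetry + Dyson — see `KineticBudgetExists`.
[cite: LSSY2005, Thm. 2.2 (2.14)] -/
theorem stub_kineticBudget : KineticBudgetExists := by
  sorry

/-- **Stub 4** (L/XL, cage half, fine scale): see `CageMoments`. [cite: GrimmettKestenZhang1993, §2] -/
theorem stub_cageMoments : CageMoments := by
  sorry

/-- **Stub 5** (L/XL, cage half, coarse scale): see `CoarseCages`. [cite: GrimmettKestenZhang1993, Thm. 1] -/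
theorem stub_coarseCages : CoarseCages := by
  sorry

/-- **Stub 6** (M/L, the beat count): see `BeatCount`. [cite: KennedyLiebShastry1988] -/
theorem stub_beatCount : BeatCount := by
  sorry

/-- **Stub 7** (XL, HARDEST, the infrared input): see `InfraredInput`. [cite: KennedyLiebShastry1988] -/
theorem stub_infraredInput : InfraredInput := by
  sorry

/-! ## §4 Composition (sorry-free): the seven stubs give the crux BY NAME -/

/-- `ℝ≥0∞` bookkeeping: `2·ofReal(a) + 12·(ofReal b · ofReal c) = ofReal(2a + 12bc)` for `a, b, c ≥ 0`.
[folklore] -/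
theorem two_mul_ofReal_add_twelve_mul (a b c : ℝ) (ha : 0 ≤ a) (hb : 0 ≤ b) (hc : 0 ≤ c) :
    2 * ENNReal.ofReal a + 12 * (ENNReal.ofReal b * ENNReal.ofReal c) =
      ENNReal.ofReal (2 * a + 12 * (b * c)) := by
  have h2 : (2 : ℝ≥0∞) = ENNReal.ofReal 2 := (ENNReal.ofReal_ofNat 2).symm
  have h12 : (12 : ℝ≥0∞) = ENNReal.ofReal 12 := (ENNReal.ofReal_ofNat 12).symm
  have hbc : 0 ≤ b * c := mul_nonneg hb hc
  rw [h2, h12, ← ENNReal.ofReal_mul hb, ← ENNReal.ofReal_mul (by norm_num : (0 : ℝ) ≤ 2),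
    ← ENNReal.ofReal_mul (by norm_num : (0 : ℝ) ≤ 12),
    ← ENNReal.ofReal_add (by positivity) (by positivity)]

/-- **`FibreConductance` from the seven stubs** (hypotheses = the seven named stub statements;
kernel-checked glue, no `sorry`). Given `v`, `M`: S3 gives the kinetic budget `(C_F, ρ_F, N_F)`; S7 gives
the occupation level `K` and its regime `(ρ₇, N₇)`; S4 (fed with S3) gives `C₃, ρ₄, N₄`; S5 gives
`C_a, ρ₅, N₅`; S6 (fed with S3 and `K`) gives `C_b, ρ₆, N₆`. Put `ρ₀ = min`, `N₀ = max`,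
`D = 2C₃ + 12 C_a C_b`, `C = 1/(2π²) + 2D`. In the regime: S2 at `ν = healingBlocks` bounds `defectDual`
by `2ℓ²·cageIntegral + 12·coarseIntegral ≤ ofReal(2C₃ x) + 12·ofReal(C_a)·ofReal(C_b x) = ofReal(D x)`,
`x = L²/‖n‖²` (S4, S5, S6 with S7's two hypotheses), and S1 turns that into the flow. [folklore] -/
theorem FibreConductance_of :
    Goal.stub_transportReduction → Goal.stub_twoScaleSplit → Goal.stub_kineticBudget →
      Goal.stub_cageMoments → Goal.stub_coarseCages → Goal.stub_beatCount → Goal.stub_infraredInput →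
      BECThomsonPrinciple.FibreConductance := by
  intro h1 h2 h3 h4 h5 h6 h7
  refine fibreConductance_iff.mpr ?_
  intro v hv hB M hM
  obtain ⟨C_F, ρ_F, _, _, N_F, hKB⟩ := h3 v hv hB
  obtain ⟨K, hK, ρ₇, hρ₇, N₇, H7⟩ := h7 v hv hB M hM
  obtain ⟨C₃, hC₃, ρ₄, hρ₄, N₄, H4⟩ := h4 v hv hB C_F ρ_F N_F hKB M hM
  obtain ⟨C_a, hCa, ρ₅, hρ₅, N₅, H5⟩ := h5 v hv hB M hM
  obtain ⟨C_b, hCb, ρ₆, hρ₆, N₆, H6⟩ := h6 v hv hB C_F ρ_F N_F hKB M hM K hK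
  set a : ℝ := (scatteringLength v).toReal with ha
  set D : ℝ := 2 * C₃ + 12 * (C_a * C_b) with hD
  have hD0 : 0 ≤ D := by rw [hD]; positivity
  have hC0 : 0 < 1 / (2 * Real.pi ^ 2) + 2 * D := by positivity
  refine ⟨min (min ρ₇ ρ₄) (min ρ₅ ρ₆), 1 / (2 * Real.pi ^ 2) + 2 * D,
    lt_min (lt_min hρ₇ hρ₄) (lt_min hρ₅ hρ₆), hC0, max (max N₇ N₄) (max N₅ N₆), ?_⟩
  intro m hm L hL hρ n hn hwin Φ hE hZ
  -- the four regimes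
  have hL3 : (0 : ℝ) ≤ L ^ 3 := by positivity
  have hρ7 : ((m + 1 : ℕ) : ℝ) ≤ ρ₇ * L ^ 3 :=
    hρ.trans (mul_le_mul_of_nonneg_right ((min_le_left _ _).trans (min_le_left _ _)) hL3)
  have hρ4' : ((m + 1 : ℕ) : ℝ) ≤ ρ₄ * L ^ 3 :=
    hρ.trans (mul_le_mul_of_nonneg_right ((min_le_left _ _).trans (min_le_right _ _)) hL3)
  have hρ5' : ((m + 1 : ℕ) : ℝ) ≤ ρ₅ * L ^ 3 :=
    hρ.trans (mul_le_mul_of_nonneg_right ((min_le_right _ _).trans (min_le_left _ _)) hL3)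
  have hρ6' : ((m + 1 : ℕ) : ℝ) ≤ ρ₆ * L ^ 3 :=
    hρ.trans (mul_le_mul_of_nonneg_right ((min_le_right _ _).trans (min_le_right _ _)) hL3)
  have hm7 : N₇ ≤ m + 1 := le_trans ((le_max_left _ _).trans (le_max_left _ _)) hm
  have hm4 : N₄ ≤ m + 1 := le_trans ((le_max_right _ _).trans (le_max_left _ _)) hm
  have hm5 : N₅ ≤ m + 1 := le_trans ((le_max_left _ _).trans (le_max_right _ _)) hm
  have hm6 : N₆ ≤ m + 1 := le_trans ((le_max_right _ _).trans (le_max_right _ _)) hm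
  -- abbreviation for the budget unit `L²/‖n‖²`
  set x : ℝ := L ^ 2 / ‖(fun j => (n j : ℝ))‖ ^ 2 with hx
  have hx0 : 0 ≤ x := by positivity
  -- the inputs
  obtain ⟨hShell, hStruct⟩ := H7 m hm7 L hL hρ7 n hn hwin Φ hE hZ
  have hcage : ENNReal.ofReal ((L / (healingBlocks m L a + 1)) ^ 2) *
      cageIntegral L (healingBlocks m L a) n Φ ≤ ENNReal.ofReal (C₃ * x) := by
    have := H4 m hm4 L hL hρ4' n hn hwin Φ hE hZ
    simpa [hx, mul_div_assoc] using this
  have hcoarse : coarseIntegral L (healingBlocks m L a) n Φ ≤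
      ENNReal.ofReal C_a * flatCoarseIntegral L (healingBlocks m L a) n Φ :=
    H5 m hm5 L hL hρ5' n hn hwin Φ hE hZ
  have hflat : flatCoarseIntegral L (healingBlocks m L a) n Φ ≤ ENNReal.ofReal (C_b * x) := by
    have := H6 m hm6 L hL hρ6' n hn hwin Φ hE hZ hShell hStruct
    simpa [hx, mul_div_assoc] using this
  -- the defect's dual norm
  have hdual : defectDual n Φ ≤ ENNReal.ofReal (D * x) := by
    calc defectDual n Φ
        ≤ 2 * (ENNReal.ofReal ((L / (healingBlocks m L a + 1)) ^ 2) * cageIntegral L (healingBlocks m L a) n Φ) +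
            12 * coarseIntegral L (healingBlocks m L a) n Φ :=
          h2 m L hL (healingBlocks m L a) n hn Φ hZ
      _ ≤ 2 * ENNReal.ofReal (C₃ * x) + 12 * (ENNReal.ofReal C_a * ENNReal.ofReal (C_b * x)) :=
          add_le_add (mul_le_mul' le_rfl hcage)
            (mul_le_mul' le_rfl (hcoarse.trans (mul_le_mul' le_rfl hflat)))
      _ = ENNReal.ofReal (2 * (C₃ * x) + 12 * (C_a * (C_b * x))) :=
          two_mul_ofReal_add_twelve_mul _ _ _ (mul_nonneg hC₃ hx0) hCa (mul_nonneg hCb hx0)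
      _ = ENNReal.ofReal (D * x) := by rw [hD]; congr 1; ring
  -- the flow
  have hdual' : defectDual n Φ ≤ ENNReal.ofReal (D * L ^ 2 / ‖(fun j => (n j : ℝ))‖ ^ 2) := by
    simpa [hx, mul_div_assoc] using hdual
  obtain ⟨Jε, _, hflow, hcost⟩ := h1 m L hL n hn Φ hZ D hD0 hdual'
  exact ⟨_, hflow, hcost⟩

/-- The crux from the REGISTERED stubs (by name): what closes stmt-AtomisticToContinuum-9480 once the
seven `sorry`s are discharged. [folklore] -/
theorem fibreConductance_of_registered_stubs : BECThomsonPrinciple.FibreConductance :=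
  FibreConductance_of stub_transportReduction stub_twoScaleSplit stub_kineticBudget stub_cageMoments
    stub_coarseCages stub_beatCount stub_infraredInput

end Summit.AtomisticToContinuum.BoseEinsteinCondensation.Cruxes.FibreConductance.HealingSplitKineticDefect

end
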